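import Literature.AlgebraicGeometry.Resolution.QuadraticTransforms
import Literature.AlgebraicGeometry.Resolution.RsopMonomialIdeals
import Literature.AlgebraicGeometry.Resolution.ArithmeticalThreefoldsMonomials
import Literature.AlgebraicGeometry.Resolution.BlowupChartRsop
import Literature.AlgebraicGeometry.Resolution.QuadraticTransformAlongPrime
import Literature.AlgebraicGeometry.Resolution.NormalCrossingsBlowupStepReduction
import Literature.AlgebraicGeometry.Resolution.QuadraticTransformsRegular
import Literature.AlgebraicGeometry.Resolution.ArithmeticalThreefolds
import Literature.AlgebraicGeometry.Resolution.RegularLocalRingsQuotient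
import Mathlib.RingTheory.Valuation.ValuationSubring
import Mathlib.Algebra.CharP.Lemmas
import Mathlib.Algebra.BigOperators.Associated
import Literature.AlgebraicGeometry.Resolution.BlowupDimension
import Literature.AlgebraicGeometry.Resolution.ShannonHullParameter
import Mathlib.Data.Set.Finite.Basic
import HarnessLib

/-!
# Heinzer–Loper–Olberding–Schoutens–Toeniskoetter Prop. 3.8 (a Shannon extension has a hull parameter) — `HeinzerEtAl2015HullParameterExists` HOLDS (re-homed proofs)

**Heinzer–Loper–Olberding–Schoutens–Toeniskoetter, Prop. 3.8 — the named fact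
`Literature.AlgebraicGeometry.Resolution.HeinzerEtAl2015HullParameterExists` (`ShannonHullParameter.lean`) HOLDS, at every universe**:
along an infinite sequence `R 0 ⊆ R 1 ⊆ ⋯` of quadratic transforms of regular local subrings of a field `K` along a dominating
valuation ring `O` (`IsQuadraticTransformAlong`), some member `R i` carries a regular parameter `x` with `𝔪_i ⊆ x·R (i+1)`
(«`xR_{i+1} = 𝔪_iR_{i+1}`») such that every element of positive value of the Shannon extension `S = ⨆ R j` has a power divisible
by `x` in `S` («`xS` is `N`-primary») — W. Heinzer, K. A. Loper, B. Olberding, H. Schoutens, M. Toeniskoetter, *Ideal theory of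
infinite directed unions of local quadratic transforms*, J. Algebra 474 (2017) 213–239 = arXiv:1505.06445, Prop. 3.8 (chunk p0008
of the held copy: «Assuming Setting 3.1, there exists a regular parameter `x` in one of the `R_i`'s such that `xR_{i+1} = 𝔪_iR_{i+1}`
and `xS` is an `N`-primary ideal of `S`.») [HeinzerEtAl2015].  The in-tree proof is ELEMENTARY ALONG THE VALUATION (no order
valuations, no essential prime divisors): exceptional parameters `x j ∈ R j` of least value (`exists_excParam`); for `k < k' < j`,
`x k' ∣ x k` in `R j`; an index `k` is DEAD at stage `j` when `x k` divides a power of `x (k+1)` in `R j`; the ETERNAL indices are at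
most `dim R 0` in number, because `x 0` stays a monomial × unit in regular parameters along the sequence (HLOST Lemma 2.7,
`stub_rsopMonomialStep` ∘ `exists_monomial_along`) and each eternal index owns one of those parameters (`card_notDead_le`, HLOST
Prop. 2.8 in this form), while `dim R j ≤ dim R 0` (Remark 2.9; Matsumura Thm. 15.5 [Matsumura1987]); past the last eternal index
every positive-value element of `S` has a power divisible by `x i` (`pow_div_mem_shannonExt_of_dead`).  RE-HOMED into `Literature/`
by the Hodge foundations lane (`lit-hodgefound`, seat p20, generation 38): verbatim DECLARATION-LEVEL ports (the declarations
needed, in dependency order; field binders `{K : Type}` of the in-tree statements generalised to `{K : Type u}`, proofs unchanged;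
the Summits-side abbreviation `shannonExt R := ⨆ i, R i` UNFOLDED to `iSup R`) of
`Summits/ResolutionOfSingularities/ResolutionOfSingularities/Theorems/FrobeniusClosingSteer{SwitchingAssembly (3 of 7 declarations),
RsopMonomialStep (5), HullVocabulary (1 of 45), Core4LowMultTwoCore (1 of 3), PersistentExceptional (10), HullParameter (2 of 3)}.lean`,
namespace `Summit.ResolutionOfSingularities.ResolutionOfSingularities.Theorems.SwitchingDichotomy` re-rooted as
`Literature.AlgebraicGeometry.Resolution.ShannonSequence` (sub-namespaces `Hull`, `LowMult` kept; in-tree `stub_…` names kept so that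
twins share short names; they are proved theorems), followed by the EXACT-name, universe-polymorphic discharge
`Literature.AlgebraicGeometry.Resolution.HeinzerEtAl2015HullParameterExists_holds : HeinzerEtAl2015HullParameterExists.{u}` (the
in-tree discharge `…SwitchingDichotomy.Hull.heinzerEtAl2015HullParameterExists_holds` is at universe `0`; same proof).  Built on the
tree's Literature layer (`QuadraticTransforms`, `QuadraticTransformsRegular`, `QuadraticTransformAlongPrime`, `BlowupChartRsop`,
`NormalCrossingsBlowupStepReduction`, `RsopMonomialIdeals`, `RegularLocalRingsQuotient`, `ArithmeticalThreefoldsMonomials`,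
`BlowupDimension`, `ShannonHullParameter`) and Mathlib; sibling of `ShannonNoetherianHullUFDProof.lean` (HLOST Thm. 4.1 (1), which
CONSUMES the hull parameter this file PRODUCES).  Theorem-only file: no definition, no new named fact (D-0026); imports
Mathlib/Literature only; every declaration carries the citation of the printed statement it formalises or serves.  The Summits
originals stay in place (transitional duplication).  WHAT THIS IS NOT: nothing here bears on resolution of singularities in
positive characteristic; this is the ideal theory of Shannon extensions.
-/

noncomputable section

universe u

/-!
## Part 1 — port of `Summits/ResolutionOfSingularities/ResolutionOfSingularities/Theorems/FrobeniusClosingSteerSwitchingAssembly.lean` (3 declarations kept)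

# Monomials in regular parameters persist along a sequence of quadratic transforms (three helper lemmas)

`prod_prod_pow_pow` (exponent bookkeeping), `exists_monomial_along` (HLOST Lemma 2.7 iterated: if every quadratic transform
along `O` turns the members of a part of a regular system of parameters into monomials in a part of a regular system of
parameters of the transform times units — hypothesis `h₁`, the statement of `stub_rsopMonomialStep` of the next Part — then an
element which is such a monomial × unit in `R i₀` is one in every later member `R (i₀ + d)`), and `exists_monomial_of_mul_eq` (a
divisor of a monomial in regular parameters of a regular local ring is a monomial × unit: the parameters are prime elements of a
UFD-free argument via `exists_eq_units_mul_prod_pow_of_dvd`).  (The source module's assembly theorem for the crux it served is not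
re-homed.)  Reference: W. Heinzer, K. A. Loper, B. Olberding, H. Schoutens, M. Toeniskoetter, *Ideal theory of infinite directed
unions of local quadratic transforms*, J. Algebra 474 (2017) 213–239 = arXiv:1505.06445, Lemma 2.7 [HeinzerEtAl2015].
-/

section Part1

open _root_.IsLocalRing
open Literature.AlgebraicGeometry.Resolution

namespace Literature.AlgebraicGeometry.Resolution.ShannonSequence

section Helpers

variable {K : Type u} [Field K]

/-- Exponent bookkeeping: `∏ᵢ (∏ₗ μₗ ^ e i l) ^ nᵢ = ∏ₗ μₗ ^ (∑ᵢ nᵢ e i l)`. [cite: HeinzerEtAl2015, Lemma 2.7 (monomials in regular parameters persist along local quadratic transforms) and its divisor form] -/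
theorem prod_prod_pow_pow {M : Type*} [CommMonoid M] {ι κ : Type*} [Fintype ι] [Fintype κ]
    (μ : κ → M) (e : ι → κ → ℕ) (n : ι → ℕ) :
    ∏ i, (∏ l, μ l ^ e i l) ^ n i = ∏ l, μ l ^ ∑ i, n i * e i l := by
  calc ∏ i, (∏ l, μ l ^ e i l) ^ n i = ∏ i, ∏ l, μ l ^ (n i * e i l) := by
        refine Finset.prod_congr rfl fun i _ => ?_
        rw [← Finset.prod_pow]
        exact Finset.prod_congr rfl fun l _ => by rw [← pow_mul, mul_comm]
    _ = ∏ l, ∏ i, μ l ^ (n i * e i l) := Finset.prod_comm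
    _ = ∏ l, μ l ^ ∑ i, n i * e i l :=
        Finset.prod_congr rfl fun l _ => Finset.prod_pow_eq_pow_sum _ _ _

/-- **Iterating the one-step monomial lemma along the sequence.** If every quadratic transform
along `O` turns members of a part of a regular system of parameters into monomials (in a part of a
regular system of parameters of the transform) times units (hypothesis `h₁` = the statement of
`stub_rsopMonomialStep`), then an element of `K` which is such a monomial times a unit in `R i₀`
is one in every later member `R (i₀ + d)` of a sequence of quadratic transforms along `O` of local
rings dominated by `O`. [cite: HeinzerEtAl2015, Lemma 2.7] -/
theorem exists_monomial_along
    (h₁ : ∀ (K : Type u) [Field K] (O : ValuationSubring K) (R R₁ : Subring K) [IsLocalRing R]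
      [IsLocalRing R₁], SubringDominates R O.toSubring → IsQuadraticTransformAlong O R R₁ →
      ∀ (s : ℕ) (z : Fin s → R), IsRsopPart z →
      ∃ (s₁ : ℕ) (z₁ : Fin s₁ → R₁), IsRsopPart z₁ ∧
        ∀ j : Fin s, ∃ (e : Fin s₁ → ℕ) (u : R₁), IsUnit u ∧
          ((z j : R) : K) = (∏ l, ((z₁ l : R₁) : K) ^ e l) * (u : K))
    (O : ValuationSubring K) (R : ℕ → Subring K) [hR : ∀ i, IsLocalRing (R i)]
    (hstep : ∀ i, IsQuadraticTransformAlong O (R i) (R (i + 1)))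
    (hdom : ∀ i, SubringDominates (R i) O.toSubring) (i₀ : ℕ) (x₀ : K)
    (hx : ∃ (s : ℕ) (z : Fin s → R i₀), IsRsopPart z ∧ ∃ (e : Fin s → ℕ) (u : R i₀), IsUnit u ∧
      x₀ = (∏ l, ((z l : R i₀) : K) ^ e l) * (u : K)) (d : ℕ) :
    ∃ (s : ℕ) (z : Fin s → R (i₀ + d)), IsRsopPart z ∧ ∃ (e : Fin s → ℕ) (u : R (i₀ + d)),
      IsUnit u ∧ x₀ = (∏ l, ((z l : R (i₀ + d)) : K) ^ e l) * (u : K) := by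
  classical
  induction d with
  | zero => exact hx
  | succ d ih =>
    obtain ⟨s, z, hz, e, u, hu, hxe⟩ := ih
    obtain ⟨s₁, z₁, hz₁, H⟩ := h₁ K O (R (i₀ + d)) (R (i₀ + d + 1)) (hdom _) (hstep _) s z hz
    choose e' u' hu' hzu' using H
    have hle : R (i₀ + d) ≤ R (i₀ + d + 1) := (hstep _).le
    refine ⟨s₁, z₁, hz₁, fun l => ∑ j, e j * e' j l, (∏ j, u' j ^ e j) * Subring.inclusion hle u,
      (IsUnit.prod_univ_iff.mpr fun j => (hu' j).pow _).mul (hu.map _), ?_⟩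
    rw [hxe]
    simp only [hzu', mul_pow]
    rw [Finset.prod_mul_distrib, prod_prod_pow_pow, mul_assoc]
    push_cast
    simp only [Subring.coe_inclusion]

/-- **A divisor of a monomial is a monomial.** In a regular local ring `S ⊆ O` inside `K`, if
`b, c ∈ S` satisfy `b · c = (∏ zₗ ^ Eₗ) · u` in `K` with `z` part of a regular system of parameters
of `S` and `u` a unit, then `b = (∏ zₗ ^ mₗ) · u'` for some exponents `m` and unit `u'` of `S` (the
`zₗ` are prime elements of the domain `S`). [cite: HeinzerEtAl2015, Lemma 2.7 (monomials in regular parameters persist along local quadratic transforms) and its divisor form] -/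
theorem exists_monomial_of_mul_eq {S : Subring K} [IsRegularLocalRing S] {s : ℕ}
    {z : Fin s → S} (hz : IsRsopPart z) (E : Fin s → ℕ) {b c : K} (hb : b ∈ S) (hc : c ∈ S)
    {u : S} (hu : IsUnit u) (h : b * c = (∏ l, ((z l : S) : K) ^ E l) * (u : K)) :
    ∃ (m : Fin s → ℕ) (u' : S), IsUnit u' ∧ b = (∏ l, ((z l : S) : K) ^ m l) * (u' : K) := by
  classical
  have key : (∏ l, z l ^ E l) * u = (⟨b, hb⟩ : S) * ⟨c, hc⟩ :=
    Subtype.ext (by push_cast; exact h.symm)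
  have hdvd : (⟨b, hb⟩ : S) ∣ ∏ l, z l ^ E l := hu.dvd_mul_right.mp ⟨⟨c, hc⟩, key⟩
  obtain ⟨c', m, hm⟩ :=
    CossartPiltantMonomial.exists_eq_units_mul_prod_pow_of_dvd (fun l => hz.prime l) E hdvd
  refine ⟨m, c', c'.isUnit, ?_⟩
  have := congrArg Subtype.val hm
  push_cast at this
  exact this.trans (mul_comm _ _)

end Helpers

end Literature.AlgebraicGeometry.Resolution.ShannonSequence

end Part1

/-!
## Part 2 — port of `Summits/ResolutionOfSingularities/ResolutionOfSingularities/Theorems/FrobeniusClosingSteerRsopMonomialStep.lean` (5 declarations kept)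

# One quadratic transform along a valuation turns regular parameters into monomials (HLOST Lemma 2.7, one step)

`stub_rsopMonomialStep` (historical name kept): for a regular local subring `R ⊆ O` of a field `K` dominated by the valuation ring
`O` and its quadratic transform `R₁` along `O` (`IsQuadraticTransformAlong`, Cutkosky §2.2), every part `z` of a regular system of
parameters of `R` becomes, member by member, a monomial in a part `z₁` of a regular system of parameters of `R₁` times a unit of
`R₁`.  Proof through the tree's abstract blow-up chart: `R₁` is the localisation at the centre of `O` of the Rees chart
`R[(x)/x_i]` at a parameter `x_i` of least value (`exists_isRsopPart_quadraticTransform_rsopStep`, with the injectivity of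
`chartToField` / `locToField` and the identification `exists_ringEquiv_of_range_eq_rsopStep`), where
`Literature/AlgebraicGeometry/Resolution/BlowupChartRsop.lean` and `NormalCrossingsBlowupStepReduction.lean` supply the regular
system of parameters of the chart.  References: S. D. Cutkosky, *Counterexamples to local monomialization in positive
characteristic*, Math. Ann. 362 (2015) §2.2 [Cutkosky2014]; [HeinzerEtAl2015, Lemma 2.7].
-/

section Part2

open _root_.IsLocalRing
open Literature.AlgebraicGeometry.Resolution

namespace Literature.AlgebraicGeometry.Resolution.ShannonSequence

/-! ## Injectivity of the chart maps into `K` -/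

/-- An injective ring map `f : A → K` with image the subring `T` gives `A ≅ T` over `K`.
[cite: Cutkosky2014, §2.2 (the quadratic transform along a valuation as the localised blow-up chart at a parameter of least value) with HeinzerEtAl2015, Lemma 2.7] -/
theorem exists_ringEquiv_of_range_eq_rsopStep {A K : Type*} [Ring A] [Ring K] (f : A →+* K)
    (hf : Function.Injective f) (T : Subring K) (hT : f.range = T) :
    ∃ e : A ≃+* T, ∀ a, (e a : K) = f a := by
  subst hT
  exact ⟨RingEquiv.ofBijective f.rangeRestrict
    ⟨fun a b h => hf (congrArg Subtype.val h :), f.rangeRestrict_surjective⟩, fun a => rfl⟩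

/-- **The chart ring embeds into `K`.** For an injective ring map `θ : A → K` into a field and a
family `c` with `θ(c_i) ≠ 0`, the map `θ₁ : (A[It])_{(c_i t)} → K` (`chartToField`,
`F(e) ↦ F(θ(c)/θ(c_i))`) is injective: write two elements as `F₁(e)`, `F₂(e)` with forms of one
degree `d`; then `φ(F_k(c)) = φ(c_i)^d F_k(e)`, `F₁(c) = F₂(c)` in `A` (compare in `K`), and
`φ(c_i)` is a non-zero-divisor on the chart (Stacks 0804). [cite: StacksProject, Tag 0804] -/
theorem chartToField_injective_rsopStep {A : Type*} [CommRing A] {K : Type*} [Field K] {n : ℕ}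
    (c : Fin n → A) (i : Fin n) (θ : A →+* K) (hθ : θ (c i) ≠ 0) (hinj : Function.Injective θ) :
    Function.Injective (chartToField c i θ hθ) := by
  classical
  -- every element is `F(e)` for a form `F` of any large degree
  have hform : ∀ (z : chartRing c i) (m : ℕ), ∃ (d : ℕ) (F : MvPolynomial (Fin n) A), m ≤ d ∧
      F.IsHomogeneous d ∧ MvPolynomial.eval₂Hom (chartBase c i) (fun j => chartGen c i j) F = z := by
    intro z m
    obtain ⟨d, F, hF, hFz⟩ := exists_isHomogeneous_eval₂_eq c i z
    refine ⟨m + d, MvPolynomial.X i ^ m * F, Nat.le_add_right m d,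
      (MvPolynomial.isHomogeneous_X_pow i m).mul hF, ?_⟩
    rw [map_mul, map_pow, MvPolynomial.eval₂Hom_X', hFz]
    exact chartGen_self_pow_mul c i m z
  intro z₁ z₂ hz
  obtain ⟨d₁, F₁, -, hF₁, rfl⟩ := hform z₁ 0
  obtain ⟨d, F₂, hle, hF₂, rfl⟩ := hform z₂ d₁
  obtain ⟨k, rfl⟩ := Nat.exists_eq_add_of_le hle
  have hG₁hom : (MvPolynomial.X i ^ k * F₁).IsHomogeneous (d₁ + k) := by
    rw [add_comm]
    exact (MvPolynomial.isHomogeneous_X_pow i k).mul hF₁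
  have hG₁e : MvPolynomial.eval₂Hom (chartBase c i) (fun j => chartGen c i j)
      (MvPolynomial.X i ^ k * F₁) =
      MvPolynomial.eval₂Hom (chartBase c i) (fun j => chartGen c i j) F₁ := by
    rw [map_mul, map_pow, MvPolynomial.eval₂Hom_X']
    exact chartGen_self_pow_mul c i k _
  have h1 := reesChartBase_eval_eq_pow_mul_eval₂ c i hG₁hom
  have h2 := reesChartBase_eval_eq_pow_mul_eval₂ c i hF₂
  rw [hG₁e] at h1
  -- compare in `K`
  have hK : θ (MvPolynomial.eval c (MvPolynomial.X i ^ k * F₁)) = θ (MvPolynomial.eval c F₂) := by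
    rw [← chartToField_reesChartBase c i θ hθ, ← chartToField_reesChartBase c i θ hθ, h1, h2,
      map_mul, map_mul, hz]
  have hA : MvPolynomial.eval c (MvPolynomial.X i ^ k * F₁) = MvPolynomial.eval c F₂ := hinj hK
  have h3 : chartBase c i (c i) ^ (d₁ + k) *
      MvPolynomial.eval₂Hom (chartBase c i) (fun j => chartGen c i j) F₁ =
      chartBase c i (c i) ^ (d₁ + k) *
      MvPolynomial.eval₂Hom (chartBase c i) (fun j => chartGen c i j) F₂ := by
    rw [← h1, ← h2, hA]
  have hnzd : chartBase c i (c i) ^ (d₁ + k) ∈ nonZeroDivisors (chartRing c i) :=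
    pow_mem (reesChartBase_mem_nonZeroDivisors (c i) (Ideal.mem_span_range_self (f := c) (x := i))) _
  exact (mul_cancel_left_mem_nonZeroDivisors hnzd).mp h3

/-- Hence **`θ_L : L = B_N → K` (`locToField`) is injective** for `θ` injective: `θ_L(b/s) =
θ₁(b)/θ₁(s)` with `θ₁(s) ≠ 0`. [cite: Cutkosky2014, §2.2 (the quadratic transform along a valuation as the localised blow-up chart at a parameter of least value) with HeinzerEtAl2015, Lemma 2.7] -/
theorem locToField_injective_rsopStep {A : Type*} [CommRing A] {K : Type*} [Field K] {n : ℕ}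
    (c : Fin n → A) (i : Fin n) (θ : A →+* K) (hθ : θ (c i) ≠ 0) (hinj : Function.Injective θ)
    (O : ValuationSubring K) (hRO : ∀ r, θ r ∈ O)
    (hmin : ∀ j, O.valuation (θ (c j)) ≤ O.valuation (θ (c i)))
    (L : Type*) [CommRing L] [Algebra (chartRing c i) L]
    [IsLocalization.AtPrime L (chartCentre c i θ hθ O hRO hmin)] :
    Function.Injective (locToField c i θ hθ O hRO hmin L) := by
  rw [injective_iff_map_eq_zero]
  intro l hl
  obtain ⟨⟨b, s⟩, rfl⟩ :=
    IsLocalization.mk'_surjective (chartCentre c i θ hθ O hRO hmin).primeCompl l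
  rw [locToField_mk', div_eq_zero_iff] at hl
  rcases hl with hb | hs
  · have hb0 : b = 0 := chartToField_injective_rsopStep c i θ hθ hinj (by rw [hb, map_zero])
    subst hb0
    exact IsLocalization.mk'_zero s
  · exact absurd hs (ne_zero_of_valuation_eq_one
      ((not_mem_chartCentre_iff c i θ hθ O hRO hmin s.1).mp s.2))

/-! ## The exceptional parameter and the strict transforms in `R₁` -/

/-- **HLOST Lemma 2.7 / de Jong 2.4 inside `K`.** Let `R ⊆ K` be a regular local ring dominated by
the valuation ring `O`, `x` a regular system of parameters of `R`, `x_i ≠ 0` of minimal value, and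
`R₁ = (R[𝔪_R/x_i])_{𝔪_O ∩ R[𝔪_R/x_i]}`. For any injective enumeration `jJ` of indices `j ≠ i`
with `x_j/x_i` of positive value, the family `(x_i, (x_{jJ k}/x_i)_k)` of elements of `R₁` is part
of a regular system of parameters of `R₁`: the Rees-chart theorem
`isRsopPart_chartFamily_reesChart` in the localisation of the chart at the centre of `O`,
transported along the isomorphism `θ_L` onto `R₁` (`range_locToField`,
`range_chartToField_eq_blowupRing`). [cite: DeJong1996, 2.4] [cite: StacksProject, Tag 0BIQ] -/
theorem exists_isRsopPart_quadraticTransform_rsopStep {K : Type u} [Field K] (R : Subring K)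
    [IsRegularLocalRing R] (O : ValuationSubring K) (hdom : SubringDominates R O.toSubring)
    {n : ℕ} (hd : (maximalIdeal R).spanFinrank = n) (x : Fin n → R)
    (hx : Ideal.span (Set.range x) = maximalIdeal R) (i : Fin n) (hxi : ((x i : R) : K) ≠ 0)
    (hmin : ∀ j, O.valuation ((x j : R) : K) ≤ O.valuation ((x i : R) : K))
    {a : ℕ} (jJ : Fin a → {j : Fin n // j ≠ i}) (hjJ : Function.Injective jJ)
    (hJ : ∀ k, O.valuation (((x (jJ k).1 : R) : K) / ((x i : R) : K)) < 1)
    (R₁ : Subring K) [IsLocalRing R₁] (hR₁ : R₁ = locAtCentre (blowupRing R ((x i : R) : K)) O) :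
    ∃ z₁ : Fin (a + 1) → R₁, IsRsopPart z₁ ∧ ((z₁ 0 : R₁) : K) = ((x i : R) : K) ∧
      ∀ k, ((z₁ (Fin.succ k) : R₁) : K) = ((x (jJ k).1 : R) : K) / ((x i : R) : K) := by
  classical
  have hθ : R.subtype (x i) ≠ 0 := hxi
  have hRO : ∀ r : R, R.subtype r ∈ O := fun r => hdom.1 r.2
  have hmin' : ∀ j, O.valuation (R.subtype (x j)) ≤ O.valuation (R.subtype (x i)) := hmin
  have hdom' : ∀ r ∈ maximalIdeal R, O.valuation (R.subtype r) < 1 := fun r hr =>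
    ((subringDominates_valuationSubring_iff hdom.1).mp hdom r).mp hr
  -- the centre of `O` on the chart and the local ring of the chart at it
  set N := chartCentre x i R.subtype hθ O hRO hmin' with hN
  have hNm : N.comap (chartBase x i) = maximalIdeal R :=
    comap_reesChartBase_chartCentre x i R.subtype hθ O hRO hmin' hdom'
  have hz' : Ideal.span (Set.range (Fin.append x Fin.elim0)) = maximalIdeal R := by
    rw [← hx]
    congr 1
    ext r
    constructor
    · rintro ⟨j, rfl⟩
      induction j using Fin.addCases with
      | left j => exact ⟨j, by simp⟩
      | right k => exact k.elim0
    · rintro ⟨j, rfl⟩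
      exact ⟨Fin.castAdd 0 j, by simp⟩
  have hJ' : ∀ k, chartGen x i (jJ k).1 ∈ N := fun k => by
    rw [hN, mem_chartCentre_iff, chartToField_chartGen]
    exact hJ k
  have hpart := isRsopPart_chartFamily_reesChart x i Fin.elim0 hz' hd N hNm
    (Localization.AtPrime N) jJ hjJ hJ'
  -- `θ_L : L ≅ R₁`
  set f := locToField x i R.subtype hθ O hRO hmin' (Localization.AtPrime N) with hf
  have hfinj : Function.Injective f :=
    locToField_injective_rsopStep x i R.subtype hθ Subtype.val_injective O hRO hmin' _
  have hrange : f.range = R₁ := by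
    rw [hR₁, hf, range_locToField,
      range_chartToField_eq_blowupRing x i R.subtype hθ hx R (Subring.range_subtype R)]
    rfl
  obtain ⟨e, he⟩ := exists_ringEquiv_of_range_eq_rsopStep f hfinj R₁ hrange
  -- the chart family, re-indexed by `Fin (a + 1)` (definitionally `Fin (a + 0 + 1)`)
  refine ⟨fun k => e (chartFamily x i Fin.elim0 (Localization.AtPrime N) (chartBase x i)
    (chartGen x i) jJ k), ?_, ?_, fun k => ?_⟩
  · exact hpart.map_ringEquiv e
  · show ((e (chartFamily x i Fin.elim0 (Localization.AtPrime N) (chartBase x i) (chartGen x i) jJ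
      (0 : Fin (a + 0 + 1))) : R₁) : K) = _
    rw [he, chartFamily, Fin.cons_zero, hf, locToField_algebraMap, chartToField_reesChartBase]
    rfl
  · show ((e (chartFamily x i Fin.elim0 (Localization.AtPrime N) (chartBase x i) (chartGen x i) jJ
      (Fin.succ (Fin.castAdd 0 k))) : R₁) : K) = _
    rw [he, chartFamily, Fin.cons_succ, Fin.append_left, hf, locToField_algebraMap,
      chartToField_chartGen]
    rfl

/-! ## The stub -/

/-- **`stub_rsopMonomialStep` (HLOST Lemma 2.7 = de Jong 1996, 2.4 / Stacks 0BIQ, inside `K`).**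
Let `R ⊆ K` be a local ring dominated by the valuation ring `O`, `R₁` its quadratic transform
along `O`, and `z` part of a regular system of parameters of `R` (so `R` is regular). Then there is
a part `z₁` of a regular system of parameters of `R₁` such that every `z_j` is a monomial in `z₁`
times a unit of `R₁`: complete `z` to a regular system of parameters `x`, let `x_i` have minimal
value, so that `R₁ = (R[𝔪/x_i])_{𝔪_O ∩ R[𝔪/x_i]}` (uniqueness of the transform along `O`); take
`z₁ = (x_i, (x_j/x_i)_{j ∈ J})` with `J` the indices `j ≠ i` for which `x_j/x_i` has positive
value (`exists_isRsopPart_quadraticTransform_rsopStep`); the other `x_j/x_i` are units of `R₁`,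
and `x_j = x_i · (x_j/x_i)`. [cite: HeinzerEtAl2015, Lemma 2.7] [cite: DeJong1996, 2.4] -/
theorem stub_rsopMonomialStep (K : Type u) [Field K] (O : ValuationSubring K) (R R₁ : Subring K)
    [IsLocalRing R] [IsLocalRing R₁] (hdom : SubringDominates R O.toSubring)
    (h : IsQuadraticTransformAlong O R R₁) (s : ℕ) (z : Fin s → R) (hz : IsRsopPart z) :
    ∃ (s₁ : ℕ) (z₁ : Fin s₁ → R₁), IsRsopPart z₁ ∧
      ∀ j : Fin s, ∃ (e : Fin s₁ → ℕ) (u : R₁), IsUnit u ∧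
        ((z j : R) : K) = (∏ l, ((z₁ l : R₁) : K) ^ e l) * (u : K) := by
  classical
  haveI := hz.isRegularLocalRing
  have hRO := h.source_le
  have hR₁O := h.target_le
  obtain ⟨e, x, hd, hx, hxz⟩ := hz.exists_rsop
  obtain ⟨_, x₀, hx₀m, hx₀0, -, -⟩ := h.exists_eq_locAtCentre
  -- some parameter is nonzero (as `𝔪_R ≠ 0`)
  have hne : ∃ j ∈ (Finset.univ : Finset (Fin (s + e))), ((x j : R) : K) ≠ 0 := by
    by_contra hcon
    have hall : ∀ j, x j = 0 := fun j => by
      by_contra hj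
      exact hcon ⟨j, Finset.mem_univ j, fun h0 => hj (Subtype.ext h0)⟩
    have hbot : Ideal.span (Set.range x) = ⊥ := by
      rw [Ideal.span_eq_bot]
      rintro _ ⟨j, rfl⟩
      exact hall j
    rw [hx] at hbot
    rw [hbot] at hx₀m
    exact hx₀0 ((Submodule.mem_bot _).mp hx₀m)
  obtain ⟨i, -, hi0, hmax⟩ := exists_max_valuation O Finset.univ (fun j => ((x j : R) : K)) hne
  have hxi : x i ≠ 0 := fun h0 => hi0 (by rw [h0]; rfl)
  -- `R₁` is the transform in the `x_i`-chart
  have hspan : Ideal.span (↑(Finset.univ.image x) : Set R) = maximalIdeal R := by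
    rw [Finset.coe_image, Finset.coe_univ, Set.image_univ, hx]
  have h' : IsQuadraticTransformAlong O R (locAtCentre (blowupRing R (x i : K)) O) := by
    refine ⟨‹_›, hRO, Finset.univ.image x, x i, hspan, Finset.mem_image_of_mem x (Finset.mem_univ i),
      hxi, ?_, ?_⟩
    · intro y hy
      obtain ⟨j, -, rfl⟩ := Finset.mem_image.mp hy
      exact hmax j (Finset.mem_univ j)
    · rw [blowupRing_eq_closure_of_span_eq (x i : K) _ hspan]
  have hR₁ : R₁ = locAtCentre (blowupRing R (x i : K)) O := h.unique h'
  -- the quotients `x_j / x_i` of positive value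
  set J : Finset {j : Fin (s + e) // j ≠ i} :=
    Finset.univ.filter fun j => O.valuation (((x j.1 : R) : K) / ((x i : R) : K)) < 1 with hJdef
  set jJ : Fin J.card → {j : Fin (s + e) // j ≠ i} := fun k => (J.equivFin.symm k).1 with hjJdef
  have hjJ : Function.Injective jJ := fun a b hab =>
    J.equivFin.symm.injective (Subtype.ext hab)
  have hJ : ∀ k, O.valuation (((x (jJ k).1 : R) : K) / ((x i : R) : K)) < 1 := fun k =>
    (Finset.mem_filter.mp (J.equivFin.symm k).2).2
  obtain ⟨z₁, hz₁, hz₁0, hz₁k⟩ := exists_isRsopPart_quadraticTransform_rsopStep R O hdom hd x hx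
    i hi0 (fun j => hmax j (Finset.mem_univ j)) jJ hjJ hJ R₁ hR₁
  refine ⟨J.card + 1, z₁, hz₁, fun j => ?_⟩
  rw [← hxz j]
  by_cases hki : Fin.castAdd e j = i
  · -- the exceptional parameter itself
    refine ⟨Pi.single 0 1, 1, isUnit_one, ?_⟩
    rw [hki, Finset.prod_eq_single (0 : Fin (J.card + 1)) (fun l _ hl => by
      rw [Pi.single_eq_of_ne hl, pow_zero]) (fun h0 => absurd (Finset.mem_univ _) h0),
      Pi.single_eq_same, pow_one, hz₁0, OneMemClass.coe_one, mul_one]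
  · have hfac : ((x (Fin.castAdd e j) : R) : K) =
        ((x i : R) : K) * (((x (Fin.castAdd e j) : R) : K) / ((x i : R) : K)) :=
      (mul_div_cancel₀ _ hi0).symm
    by_cases hv : O.valuation (((x (Fin.castAdd e j) : R) : K) / ((x i : R) : K)) < 1
    · -- a strict transform through the new centre: `x_j = x_i · (x_j / x_i)`, both in `z₁`
      have hmem : (⟨Fin.castAdd e j, hki⟩ : {j : Fin (s + e) // j ≠ i}) ∈ J :=
        Finset.mem_filter.mpr ⟨Finset.mem_univ _, hv⟩
      set m : Fin J.card := J.equivFin ⟨_, hmem⟩ with hm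
      have hjm : jJ m = ⟨Fin.castAdd e j, hki⟩ := by
        rw [hjJdef, hm]
        dsimp only
        rw [Equiv.symm_apply_apply]
      have hl₁ : (0 : Fin (J.card + 1)) ≠ Fin.succ m :=
        (Fin.succ_ne_zero _).symm
      refine ⟨Pi.single 0 1 + Pi.single (Fin.succ m) 1, 1, isUnit_one, ?_⟩
      rw [Finset.prod_eq_mul (0 : Fin (J.card + 1)) (Fin.succ m) hl₁
        (fun c _ hc => by
          rw [Pi.add_apply, Pi.single_eq_of_ne hc.1, Pi.single_eq_of_ne hc.2, add_zero, pow_zero])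
        (fun h0 => absurd (Finset.mem_univ _) h0) (fun h0 => absurd (Finset.mem_univ _) h0),
        Pi.add_apply, Pi.add_apply, Pi.single_eq_same, Pi.single_eq_same, Pi.single_eq_of_ne hl₁,
        Pi.single_eq_of_ne hl₁.symm, add_zero, zero_add, pow_one, pow_one, hz₁0, hz₁k m, hjm,
        OneMemClass.coe_one, mul_one]
      exact hfac
    · -- a strict transform off the new centre: `x_j / x_i` is a unit of `R₁`
      have hwR₁ : ((x (Fin.castAdd e j) : R) : K) / ((x i : R) : K) ∈ R₁ := by
        rw [hR₁]
        exact le_locAtCentre _ O (div_mem_blowupRing _ (hx ▸ Ideal.subset_span ⟨_, rfl⟩))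
      have hv1 : O.valuation (((x (Fin.castAdd e j) : R) : K) / ((x i : R) : K)) = 1 :=
        le_antisymm ((O.valuation_le_one_iff _).mpr (hR₁O hwR₁)) (not_lt.mp hv)
      refine ⟨Pi.single 0 1, ⟨_, hwR₁⟩, ?_, ?_⟩
      · rw [isUnit_subring_iff_inv_mem]
        refine ⟨ne_zero_of_valuation_eq_one hv1, ?_⟩
        have hwL : ((x (Fin.castAdd e j) : R) : K) / ((x i : R) : K) ∈
            locAtCentre (blowupRing R (x i : K)) O := by
          rw [← hR₁]
          exact hwR₁
        show (((x (Fin.castAdd e j) : R) : K) / ((x i : R) : K))⁻¹ ∈ R₁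
        rw [hR₁]
        exact inv_mem_locAtCentre hwL hv1
      · rw [Finset.prod_eq_single (0 : Fin (J.card + 1)) (fun l _ hl => by
          rw [Pi.single_eq_of_ne hl, pow_zero]) (fun h0 => absurd (Finset.mem_univ _) h0),
          Pi.single_eq_same, pow_one, hz₁0]
        exact hfac

end Literature.AlgebraicGeometry.Resolution.ShannonSequence

end Part2

/-!
## Part 3 — port of `Summits/ResolutionOfSingularities/ResolutionOfSingularities/Theorems/FrobeniusClosingSteerHullVocabulary.lean` (1 declarations kept)

# The Shannon extension `S = ⋃ R_i` (one bookkeeping lemma)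

`le_shannonExt : R i ≤ iSup R` — a member of the sequence lies in the Shannon extension `S = ⨆ i, R i` (HLOST Setting 3.1 (3);
the Summits-side abbreviation `shannonExt R := ⨆ i, R i` is UNFOLDED throughout this port, so that the discharge below meets the
named fact's `(⨆ i, R i : Subring K)` on the nose).  (The source module's hull / near / far vocabulary is not re-homed.)
Reference: [HeinzerEtAl2015, Setting 3.1].
-/

section Part3

set_option autoImplicit false

namespace Literature.AlgebraicGeometry.Resolution.ShannonSequence.Hull

open _root_.IsLocalRing
open Literature.AlgebraicGeometry.Resolution

variable {K : Type u} [Field K]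

/-- A member of the sequence lies in the Shannon extension `S = ⨆ i, R i` (`iSup R`; the Summits-side abbreviation `shannonExt R`
is unfolded in this port). [cite: HeinzerEtAl2015, Setting 3.1 (3)] -/
theorem le_shannonExt (R : ℕ → Subring K) (i : ℕ) : R i ≤ iSup R :=
  le_iSup R i

end Literature.AlgebraicGeometry.Resolution.ShannonSequence.Hull

end Part3

/-!
## Part 4 — port of `Summits/ResolutionOfSingularities/ResolutionOfSingularities/Theorems/FrobeniusClosingSteerCore4LowMultTwoCore.lean` (1 declarations kept)

# An element of `𝔪 ∖ 𝔪²` of a regular local ring is a regular parameter (one lemma)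

`isRsopPart_one_of_not_mem_sq`: in a regular local ring, `h ∈ 𝔪 ∖ 𝔪²` is a one-element part of a regular system of parameters
(`IsRsopPart` on `Fin 1`; Matsumura Thm. 14.2: `𝔪/𝔪²` has dimension `dim R`, extend the nonzero class of `h` to a basis).
(The source module's multiplicity-two core is not re-homed.)  Reference: H. Matsumura, *Commutative Ring Theory*, CUP 1986,
Thm. 14.2 [Matsumura1987].
-/

section Part4

open _root_.IsLocalRing
open Literature.AlgebraicGeometry.Resolution

namespace Literature.AlgebraicGeometry.Resolution.ShannonSequence.LowMult

variable {K : Type u} [Field K]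

/-! ### Exceptional parameters exist -/

/-- In a regular local ring, an element of `𝔪 ∖ 𝔪²` is a one-element part of a regular system of
parameters (Matsumura Thm. 14.2: `R/(h)` is regular of dimension `dim R - 1`). [cite: Matsumura1987, Thm. 14.2 (an element of 𝔪 ∖ 𝔪² of a regular local ring is a regular parameter)] -/
theorem isRsopPart_one_of_not_mem_sq {R : Type u} [CommRing R] [IsRegularLocalRing R] {h : R}
    (hh : h ∈ maximalIdeal R) (hh2 : h ∉ maximalIdeal R ^ 2) : IsRsopPart (fun _ : Fin 1 => h) := by
  obtain ⟨hq, hdim⟩ := IsRegularLocalRing.quotient_span_singleton hh hh2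
  have hr : Set.range (fun _ : Fin 1 => h) = {h} := Set.range_const
  have hq' : IsRegularLocalRing (R ⧸ Ideal.span (Set.range fun _ : Fin 1 => h)) := by rw [hr]; exact hq
  have hdim' : ringKrullDim (R ⧸ Ideal.span (Set.range fun _ : Fin 1 => h)) + (1 : ℕ) ≤ ringKrullDim R := by
    rw [hr, Nat.cast_one]
    exact hdim.le
  exact IsRsopPart.of_isRegularLocalRing_quotient (fun _ => hh) (hq := hq') hdim'

/-! ### Characteristic 2: every stage steps or is of order one -/

end Literature.AlgebraicGeometry.Resolution.ShannonSequence.LowMult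

end Part4

/-!
## Part 5 — port of `Summits/ResolutionOfSingularities/ResolutionOfSingularities/Theorems/FrobeniusClosingSteerPersistentExceptional.lean` (10 declarations kept)

# Persistent exceptional divisors are finitely many (HLOST Prop. 2.8, made elementary along the valuation)

SETTING.  `R 0 ⊆ R 1 ⊆ ⋯ ⊆ O` a sequence of quadratic transforms of regular local subrings of a field `K` along the valuation
ring `O` (every member dominated by `O`), and EXCEPTIONAL PARAMETERS `x j ∈ R j`: `x j ≠ 0`, of positive value, with
`𝔪_j ⊆ x_j · R (j+1)` (every element of `R j` of positive value is divisible by `x j` in `R (j+1)`).  Such `x j` exist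
(`exists_excParam`: the generator of minimal value of `IsQuadraticTransformAlong.exists_eq_locAtCentre`; it is moreover a regular
parameter of `R j`).

THE DIVISIBILITY BOOKKEEPING (no strict transforms, no order valuations).  For `k < k' < j`, `x k'` DIVIDES `x k` in `R j`
(`div_excParam_mem`).  Call the index `k` DEAD AT STAGE `j` if `x k` divides a power of `x (k+1)` in `R j` (all the prime factors of
`x k` in the regular local ring `R j` — the exceptional prime divisors created at stages `≥ k` still passing through the centre of
`R j` — already divide `x (k+1)`), and ETERNAL if it is dead at no stage (`k`'s own exceptional divisor passes through every later
centre).  **`card_notDead_le`**: a finite set of eternal indices below `j − 1` has at most `s` elements whenever `x 0` is a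
monomial × unit on an `s`-element part of a regular system of parameters of `R j` — which holds at EVERY stage with `s ≤ dim R j`
(`exists_monomial_along` ∘ `stub_rsopMonomialStep`, HLOST Lemma 2.7; `card_notDead_le_ringKrullDim`): the divisors `x k`, `x (k+1)`
of `x 0` are monomials × units on the same part (`exists_monomial_of_mul_eq`); an eternal `k` owns a parameter `z l_k` dividing
`x k` but not `x (k+1)` (`pow_div_mem_of_support_subset`, `not_pow_div_mem_of_exponent`), and `k ↦ l_k` is injective since
`x k' ∣ x (k+1)` for `k < k'`.  With a uniform dimension bound this is HLOST Prop. 2.8 («`epd(S/R)` contains at most `dim R − 1` of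
the order valuation rings»; here `≤ dim`, all the hull-parameter existence needs).  The next Part turns «finitely many eternal
indices» (`pow_div_mem_shannonExt_of_dead`) into HLOST Prop. 3.8.  References: [HeinzerEtAl2015] Lemma 2.7, Prop. 2.8, Prop. 3.8;
[Cutkosky2014] §2.2.
-/

section Part5

set_option autoImplicit false

namespace Literature.AlgebraicGeometry.Resolution.ShannonSequence.Hull

open _root_.IsLocalRing
open Literature.AlgebraicGeometry.Resolution
open Literature.AlgebraicGeometry.Resolution.ShannonSequence
  (exists_monomial_along exists_monomial_of_mul_eq stub_rsopMonomialStep)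
open Literature.AlgebraicGeometry.Resolution.ShannonSequence.LowMult
  (isRsopPart_one_of_not_mem_sq)

variable {K : Type u} [Field K]

/-! ## Exceptional parameters -/

/-- In a local subring `R ⊆ O` dominated by `O`, an element of `𝔪_R²` has value strictly below the value of any nonzero
element `x ∈ 𝔪_R` of maximal value in `𝔪_R` (i.e. minimal valuation): `v(ab) = v(a) v(b) ≤ v(x)² < v(x)`. [cite: HeinzerEtAl2015, Prop. 2.8 (finitely many essential prime divisors; here: finitely many eternal exceptional indices) with Lemma 2.7] -/
theorem valuation_lt_of_mem_sq {O : ValuationSubring K} {R : Subring K} [IsLocalRing R]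
    (hdom : SubringDominates R O.toSubring) {x : R} (hx0 : x ≠ 0) (hxm : x ∈ maximalIdeal R)
    (hmax : ∀ y ∈ maximalIdeal R, O.valuation (y : K) ≤ O.valuation (x : K))
    {y : R} (hy : y ∈ maximalIdeal R ^ 2) : O.valuation (y : K) < O.valuation (x : K) := by
  have hRO : R ≤ O.toSubring := hdom.1
  have hvx : O.valuation (x : K) < 1 := ((subringDominates_valuationSubring_iff hRO).mp hdom x).mp hxm
  have hvx0 : 0 < O.valuation (x : K) := (Valuation.pos_iff _).mpr (fun h => hx0 (Subtype.ext h))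
  -- the bound `v(y) ≤ v(x)^2` holds on `𝔪²` (closed under the generators `a*b` and sums)
  have key : ∀ y ∈ maximalIdeal R ^ 2, O.valuation (y : K) ≤ O.valuation (x : K) ^ 2 := by
    intro y hy
    rw [pow_two] at hy
    refine Submodule.mul_induction_on hy (fun a ha b hb => ?_) (fun a b ha hb => ?_)
    · rw [Subring.coe_mul, map_mul, pow_two]
      exact mul_le_mul' (hmax a ha) (hmax b hb)
    · rw [Subring.coe_add]
      exact (Valuation.map_add _ _ _).trans (max_le ha hb)
  calc O.valuation (y : K) ≤ O.valuation (x : K) ^ 2 := key y hy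
    _ < O.valuation (x : K) := by
        rw [pow_two]
        exact mul_lt_of_lt_one_left hvx0 hvx

/-- **Exceptional parameters exist at every step.** For a quadratic transform `R → R₁` along `O` of a regular local ring
dominated by `O` there is `x ∈ R`, nonzero of positive value, a one-element part of a regular system of parameters of `R`, such
that every element of `R` of positive value is divisible by `x` in `R₁` (`𝔪_R ⊆ x R₁`, i.e. `𝔪_R R₁ = x R₁`): the generator of
minimal value. [cite: HeinzerEtAl2015, Lemma 2.7] [folklore] -/
theorem exists_excParam {O : ValuationSubring K} {R R₁ : Subring K} [IsRegularLocalRing R]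
    (hdom : SubringDominates R O.toSubring) (h : IsQuadraticTransformAlong O R R₁) :
    ∃ x : K, ∃ hxR : x ∈ R, x ≠ 0 ∧ O.valuation x < 1 ∧ IsRsopPart (fun _ : Fin 1 => (⟨x, hxR⟩ : R)) ∧
      ∀ y : K, y ∈ R → O.valuation y < 1 → y / x ∈ R₁ := by
  classical
  have hRO : R ≤ O.toSubring := hdom.1
  obtain ⟨_, x, hxm, hx0, hmax, hR₁⟩ := h.exists_eq_locAtCentre
  have hvx : O.valuation (x : K) < 1 := ((subringDominates_valuationSubring_iff hRO).mp hdom x).mp hxm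
  have hx2 : x ∉ maximalIdeal R ^ 2 := fun h2 => lt_irrefl _ (valuation_lt_of_mem_sq hdom hx0 hxm hmax h2)
  refine ⟨(x : K), x.2, fun h0 => hx0 (Subtype.ext h0), hvx, ?_, fun y hy hvy => ?_⟩
  · have : (⟨(x : K), x.2⟩ : R) = x := Subtype.ext rfl
    rw [this]
    exact isRsopPart_one_of_not_mem_sq hxm hx2
  · have hym : (⟨y, hy⟩ : R) ∈ maximalIdeal R :=
      ((subringDominates_valuationSubring_iff hRO).mp hdom ⟨y, hy⟩).mpr hvy
    rw [hR₁]
    exact le_locAtCentre _ O (div_mem_blowupRing (x : K) hym)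

/-! ## Divisibility down the sequence -/

section Sequence

variable {O : ValuationSubring K} {R : ℕ → Subring K}
  (hstep : ∀ i, IsQuadraticTransformAlong O (R i) (R (i + 1)))
  (x : ℕ → K) (hxR : ∀ j, x j ∈ R j) (hx0 : ∀ j, x j ≠ 0) (hxv : ∀ j, O.valuation (x j) < 1)
  (hxdiv : ∀ j, ∀ y : K, y ∈ R j → O.valuation y < 1 → y / x j ∈ R (j + 1))

include hstep hxR hxv hxdiv in
/-- For `k < k'`, `x k / x k' ∈ R j` whenever `k' < j`: the later exceptional parameter divides the earlier one (`x k ∈ 𝔪_{k'}`).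
[cite: HeinzerEtAl2015, Prop. 2.8 (finitely many essential prime divisors; here: finitely many eternal exceptional indices) with Lemma 2.7] -/
theorem div_excParam_mem {k k' j : ℕ} (hkk' : k < k') (hk'j : k' < j) : x k / x k' ∈ R j := by
  have hmono : Monotone R := sequence_monotone hstep
  have hk : x k ∈ R k' := hmono hkk'.le (hxR k)
  exact hmono (Nat.succ_le_of_lt hk'j) (hxdiv k' (x k) hk (hxv k))

include hx0 in
/-- Transitivity of «dead», in the form used for `N`-primarity: if every index in `[i, j')` is dead at some stage, then
`x j' ^ m / x i` lies in the Shannon extension for some `m`. [cite: HeinzerEtAl2015, Prop. 2.8 (finitely many essential prime divisors; here: finitely many eternal exceptional indices) with Lemma 2.7] -/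
theorem pow_div_mem_shannonExt_of_dead {i j' : ℕ} (hij' : i ≤ j')
    (hdead : ∀ k, i ≤ k → k < j' → ∃ (j m : ℕ), x (k + 1) ^ m / x k ∈ R j) :
    ∃ m : ℕ, x j' ^ m / x i ∈ iSup R := by
  induction j', hij' using Nat.le_induction with
  | base => exact ⟨1, by rw [pow_one, div_self (hx0 i)]; exact Subring.one_mem _⟩
  | succ j' hij' ih =>
    obtain ⟨m₁, hm₁⟩ := ih fun k hik hkj' => hdead k hik (Nat.lt_succ_of_lt hkj')
    obtain ⟨j, m₂, hm₂⟩ := hdead j' hij' (Nat.lt_succ_self j')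
    refine ⟨m₂ * m₁, ?_⟩
    have : x (j' + 1) ^ (m₂ * m₁) / x i = (x (j' + 1) ^ m₂ / x j') ^ m₁ * (x j' ^ m₁ / x i) := by
      rw [pow_mul, div_pow]
      field_simp [hx0 j', hx0 i, pow_ne_zero m₁ (hx0 j')]
    rw [this]
    exact Subring.mul_mem _ (Subring.pow_mem _ (le_shannonExt R j hm₂) m₁) hm₁

end Sequence

/-! ## Monomial × unit presentations: divisibility is support containment -/

/-- In a regular local ring, a prime parameter `z l` divides a monomial × unit `∏ z^b · u` only if the exponent `b l` is positive.
[cite: HeinzerEtAl2015, Prop. 2.8 (finitely many essential prime divisors; here: finitely many eternal exceptional indices) with Lemma 2.7] -/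
theorem exponent_ne_zero_of_dvd {S : Subring K} [IsLocalRing S] {s : ℕ} {z : Fin s → S} (hz : IsRsopPart z)
    (b : Fin s → ℕ) {u : S} (hu : IsUnit u) {l : Fin s} (hdvd : z l ∣ (∏ l', z l' ^ b l') * u) : b l ≠ 0 := by
  classical
  haveI := hz.isRegularLocalRing
  have hp : Prime (z l) := hz.prime l
  rcases hp.dvd_or_dvd hdvd with h | h
  · obtain ⟨l', -, hl'⟩ := hp.exists_mem_finset_dvd h
    have hzl' : z l ∣ z l' := hp.dvd_of_dvd_pow hl'
    have hll' : l = l' := by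
      by_contra hne
      exact hz.not_dvd hne hzl'
    subst hll'
    intro hb
    rw [hb, pow_zero] at hl'
    exact hp.not_unit (isUnit_of_dvd_one hl')
  · exact absurd (isUnit_of_dvd_unit h hu) hp.not_unit

/-- Divisibility inside `S` from divisibility data in `K`: if `a, c ∈ S` and `b = a · c` then `a ∣ b` in `S`. [cite: HeinzerEtAl2015, Prop. 2.8 (finitely many essential prime divisors; here: finitely many eternal exceptional indices) with Lemma 2.7] -/
theorem dvd_of_mul_eq_mem {S : Subring K} {a b c : K} (ha : a ∈ S) (hb : b ∈ S) (hc : c ∈ S) (h : a * c = b) :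
    (⟨a, ha⟩ : S) ∣ ⟨b, hb⟩ :=
  ⟨⟨c, hc⟩, Subtype.ext (by simpa using h.symm)⟩

/-- **Support containment gives divisibility of a power.** If `a = ∏ z^α · u` and `b = ∏ z^β · u'` are monomials × units on the
same part `z` of a regular system of parameters of `S ⊆ K`, and every `z l` occurring in `a` occurs in `b` (`α l ≠ 0 → β l ≠ 0`),
then `b ^ m / a ∈ S` for `m = Σ α`. [cite: HeinzerEtAl2015, Prop. 2.8 (finitely many essential prime divisors; here: finitely many eternal exceptional indices) with Lemma 2.7] -/
theorem pow_div_mem_of_support_subset {S : Subring K} [IsLocalRing S] {s : ℕ} {z : Fin s → S} (hz : IsRsopPart z)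
    (α β : Fin s → ℕ) (u u' : S) (hu : IsUnit u) {a b : K}
    (ha : a = (∏ l, ((z l : S) : K) ^ α l) * (u : K)) (hb : b = (∏ l, ((z l : S) : K) ^ β l) * (u' : K))
    (hsupp : ∀ l, α l ≠ 0 → β l ≠ 0) :
    ∃ m : ℕ, b ^ m / a ∈ S := by
  classical
  set m : ℕ := ∑ l, α l with hm
  refine ⟨m, ?_⟩
  -- `m · β l ≥ α l` for every `l`
  have hle : ∀ l, α l ≤ m * β l := by
    intro l
    by_cases h0 : α l = 0
    · rw [h0]; exact Nat.zero_le _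
    · have hβ : 1 ≤ β l := Nat.one_le_iff_ne_zero.mpr (hsupp l h0)
      have hα : α l ≤ m := by
        rw [hm]; exact Finset.single_le_sum (fun l _ => Nat.zero_le (α l)) (Finset.mem_univ l)
      calc α l ≤ m := hα
        _ = m * 1 := (mul_one m).symm
        _ ≤ m * β l := Nat.mul_le_mul_left m hβ
  obtain ⟨u₁, hu₁⟩ := hu
  have hUU : ((u : S) : K) * ((↑u₁⁻¹ : S) : K) = 1 := by
    rw [← hu₁, ← Subring.coe_mul, Units.mul_inv, Subring.coe_one]
  have hu0 : (u : K) ≠ 0 := left_ne_zero_of_mul_eq_one hUU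
  have hz0 : ∀ l, ((z l : S) : K) ≠ 0 := fun l h0 => hz.ne_zero l (Subtype.ext h0)
  have ha0 : a ≠ 0 := by
    rw [ha]
    exact mul_ne_zero (Finset.prod_ne_zero_iff.mpr fun l _ => pow_ne_zero _ (hz0 l)) hu0
  -- the quotient `c = ∏ z^(mβ − α) · u'^m · u⁻¹ ∈ S`
  set c : K := (∏ l, ((z l : S) : K) ^ (m * β l - α l)) * (((u' ^ m : S) : K) * ((↑u₁⁻¹ : S) : K)) with hc
  have hcS : c ∈ S := by
    refine Subring.mul_mem _ (Subring.prod_mem _ fun l _ => Subring.pow_mem _ (z l).2 _) ?_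
    exact Subring.mul_mem _ (u' ^ m).2 (↑u₁⁻¹ : S).2
  have hkey : b ^ m = a * c := by
    have h1 : ∀ l, ((z l : S) : K) ^ α l * ((z l : S) : K) ^ (m * β l - α l) = ((z l : S) : K) ^ (m * β l) :=
      fun l => by rw [← pow_add, Nat.add_sub_cancel' (hle l)]
    calc b ^ m = (∏ l, ((z l : S) : K) ^ (m * β l)) * (u' : K) ^ m := by
          rw [hb, mul_pow, ← Finset.prod_pow]
          congr 1
          exact Finset.prod_congr rfl (fun l _ => by rw [← pow_mul, mul_comm])
      _ = (∏ l, ((z l : S) : K) ^ α l * ((z l : S) : K) ^ (m * β l - α l)) *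
            (((u : S) : K) * ((↑u₁⁻¹ : S) : K)) * (u' : K) ^ m := by
          rw [hUU, mul_one]
          congr 1
          exact Finset.prod_congr rfl (fun l _ => (h1 l).symm)
      _ = a * c := by
          rw [ha, hc, Finset.prod_mul_distrib, SubmonoidClass.coe_pow]
          ring
  rw [hkey, mul_div_cancel_left₀ c ha0]
  exact hcS

/-- Conversely, if `z l` occurs in `a` but not in `b`, no power of `b` is divisible by `a` in `S`. [cite: HeinzerEtAl2015, Prop. 2.8 (finitely many essential prime divisors; here: finitely many eternal exceptional indices) with Lemma 2.7] -/
theorem not_pow_div_mem_of_exponent {S : Subring K} [IsLocalRing S] {s : ℕ} {z : Fin s → S} (hz : IsRsopPart z)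
    (α β : Fin s → ℕ) (u u' : S) (hu : IsUnit u) (hu' : IsUnit u') {a b : K}
    (ha : a = (∏ l, ((z l : S) : K) ^ α l) * (u : K)) (hb : b = (∏ l, ((z l : S) : K) ^ β l) * (u' : K))
    {l : Fin s} (hαl : α l ≠ 0) (hβl : β l = 0) (m : ℕ) : b ^ m / a ∉ S := by
  classical
  haveI := hz.isRegularLocalRing
  intro hmem
  have hz0 : ∀ l, ((z l : S) : K) ≠ 0 := fun l h0 => hz.ne_zero l (Subtype.ext h0)
  have haS : a ∈ S := by
    rw [ha]; exact Subring.mul_mem _ (Subring.prod_mem _ fun l _ => Subring.pow_mem _ (z l).2 _) u.2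
  have hbS : b ^ m ∈ S := by
    rw [hb]
    exact Subring.pow_mem _ (Subring.mul_mem _ (Subring.prod_mem _ fun l _ => Subring.pow_mem _ (z l).2 _) u'.2) m
  obtain ⟨u₁, hu₁⟩ := hu
  have hUU : ((u : S) : K) * ((↑u₁⁻¹ : S) : K) = 1 := by
    rw [← hu₁, ← Subring.coe_mul, Units.mul_inv, Subring.coe_one]
  have hu0 : (u : K) ≠ 0 := left_ne_zero_of_mul_eq_one hUU
  have ha0 : a ≠ 0 := by
    rw [ha]
    exact mul_ne_zero (Finset.prod_ne_zero_iff.mpr fun l _ => pow_ne_zero _ (hz0 l)) hu0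
  -- `a ∣ b ^ m` in `S`
  have hdvd : (⟨a, haS⟩ : S) ∣ ⟨b ^ m, hbS⟩ :=
    dvd_of_mul_eq_mem haS hbS hmem (by rw [← mul_div_assoc, mul_div_cancel_left₀ _ ha0])
  -- `z l ∣ a` in `S` (its exponent in `a` is positive)
  have heqa : (⟨a, haS⟩ : S) = (∏ l', z l' ^ α l') * u := by
    apply Subtype.ext
    change a = _
    rw [ha]
    push_cast
    rfl
  have hzla : z l ∣ (⟨a, haS⟩ : S) := by
    rw [heqa]
    exact ((dvd_pow_self (z l) hαl).trans (Finset.dvd_prod_of_mem (fun l' => z l' ^ α l') (Finset.mem_univ l))).mul_right u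
  -- hence `z l ∣ b ^ m = ∏ z^(mβ) · u'^m`, contradicting `β l = 0`
  have heqb : (⟨b ^ m, hbS⟩ : S) = (∏ l', z l' ^ (m * β l')) * u' ^ m := by
    apply Subtype.ext
    change b ^ m = _
    push_cast
    rw [hb, mul_pow, ← Finset.prod_pow]
    congr 1
    exact Finset.prod_congr rfl (fun l _ => by rw [← pow_mul, mul_comm])
  have hzlb : z l ∣ (∏ l', z l' ^ (m * β l')) * u' ^ m := by
    rw [← heqb]
    exact hzla.trans hdvd
  have hne := exponent_ne_zero_of_dvd hz (fun l' => m * β l') (hu'.pow m) hzlb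
  exact hne (by rw [hβl, mul_zero])

/-! ## The milestone: eternal indices are bounded by the number of live exceptional parameters -/

/-- **Finitely many persistent exceptional divisors (HLOST Prop. 2.8, divisibility form).** Along a sequence of quadratic
transforms with exceptional parameters `x`, let `x 0` be a monomial × unit on an `s`-element part `z` of a regular system of
parameters of the member `R j`.  Then a finite set `F` of indices `k` with `k + 1 < j` that are NOT dead at stage `j` (no power of
`x (k+1)` is divisible by `x k` in `R j`) has at most `s` elements: each such `k` owns a parameter `z l_k` dividing `x k` but not
`x (k+1)`, and `k ↦ l_k` is injective because `x k' ∣ x (k+1)` for `k < k'`. OURS. [cite: HeinzerEtAl2015, Prop. 2.8] -/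
theorem card_notDead_le {O : ValuationSubring K} {R : ℕ → Subring K}
    (hstep : ∀ i, IsQuadraticTransformAlong O (R i) (R (i + 1)))
    (x : ℕ → K) (hxR : ∀ j, x j ∈ R j) (hx0 : ∀ j, x j ≠ 0) (hxv : ∀ j, O.valuation (x j) < 1)
    (hxdiv : ∀ j, ∀ y : K, y ∈ R j → O.valuation y < 1 → y / x j ∈ R (j + 1))
    {j : ℕ} [IsLocalRing (R j)] {s : ℕ} {z : Fin s → R j} (hz : IsRsopPart z) (e : Fin s → ℕ) (u : R j)
    (hu : IsUnit u) (hx0j : x 0 = (∏ l, ((z l : R j) : K) ^ e l) * (u : K))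
    (F : Finset ℕ) (hFj : ∀ k ∈ F, k + 1 < j) (hF : ∀ k ∈ F, ∀ m : ℕ, x (k + 1) ^ m / x k ∉ R j) :
    F.card ≤ s := by
  classical
  haveI := hz.isRegularLocalRing
  have hmono : Monotone R := sequence_monotone hstep
  -- every `x k`, `k < j`, divides `x 0` in `R j`, hence is a monomial × unit on `z`
  have hpres : ∀ k, k < j → ∃ (a : Fin s → ℕ) (w : R j), IsUnit w ∧
      x k = (∏ l, ((z l : R j) : K) ^ a l) * (w : K) := by
    intro k hk
    rcases Nat.eq_zero_or_pos k with rfl | hkpos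
    · exact ⟨e, u, hu, hx0j⟩
    · have hq : x 0 / x k ∈ R j := div_excParam_mem hstep x hxR hxv hxdiv hkpos hk
      have hxk : x k ∈ R j := hmono hk.le (hxR k)
      refine exists_monomial_of_mul_eq hz e hxk hq hu ?_
      rw [← mul_div_assoc, mul_div_cancel_left₀ _ (hx0 k)]
      exact hx0j
  choose! a w hw hxa using hpres
  -- for `k ∈ F`: a parameter occurring in `x k` but not in `x (k+1)` (recorded by its index in `ℕ`)
  have hsel : ∀ k ∈ F, ∃ l : ℕ, ∃ hl : l < s, a k ⟨l, hl⟩ ≠ 0 ∧ a (k + 1) ⟨l, hl⟩ = 0 := by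
    intro k hk
    have hkj : k < j := by have := hFj k hk; omega
    have hk1 : k + 1 < j := hFj k hk
    by_contra hcon
    push Not at hcon
    have hcon' : ∀ l : Fin s, a k l ≠ 0 → a (k + 1) l ≠ 0 := fun l hl h0 => hcon l.1 l.2 hl h0
    obtain ⟨m, hm⟩ := pow_div_mem_of_support_subset hz (a k) (a (k + 1)) (w k) (w (k + 1)) (hw k hkj)
      (hxa k hkj) (hxa (k + 1) hk1) hcon'
    exact hF k hk m hm
  choose! sel hsl hsel1 hsel2 using hsel
  -- `sel` is injective on `F`
  have hne : ∀ k ∈ F, ∀ k' ∈ F, k < k' → sel k ≠ sel k' := by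
    intro k hk k' hk' hlt heq
    have hk1 : k + 1 < j := hFj k hk
    have hk'j : k' < j := by have := hFj k' hk'; omega
    -- `x (k+1) / x k' ∈ R j`
    have hmem : x (k + 1) ^ 1 / x k' ∈ R j := by
      rw [pow_one]
      rcases Nat.lt_or_ge (k + 1) k' with h | h
      · exact div_excParam_mem hstep x hxR hxv hxdiv h hk'j
      · have : k' = k + 1 := by omega
        subst this
        rw [div_self (hx0 _)]
        exact Subring.one_mem _
    -- but `z (sel k')` occurs in `x k'` and not in `x (k+1)`
    have hfin : (⟨sel k, hsl k hk⟩ : Fin s) = ⟨sel k', hsl k' hk'⟩ := Fin.ext heq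
    have h2 : a (k + 1) ⟨sel k', hsl k' hk'⟩ = 0 := by rw [← hfin]; exact hsel2 k hk
    exact not_pow_div_mem_of_exponent hz (a k') (a (k + 1)) (w k') (w (k + 1)) (hw k' hk'j) (hw (k + 1) hk1)
      (hxa k' hk'j) (hxa (k + 1) hk1) (hsel1 k' hk') h2 1 hmem
  have hinj : Set.InjOn sel (F : Set ℕ) := by
    intro k hk k' hk' heq
    by_contra hkk'
    rcases Nat.lt_or_gt_of_ne hkk' with h | h
    · exact hne k hk k' hk' h heq
    · exact hne k' hk' k hk h heq.symm
  calc F.card ≤ (Finset.range s).card :=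
        Finset.card_le_card_of_injOn sel (fun k hk => Finset.mem_coe.mpr (Finset.mem_range.mpr (hsl k hk))) hinj
    _ = s := Finset.card_range s

/-- **At every stage, `x 0` is a monomial × unit on a part of a regular system of parameters of size `≤ dim R j`** — so the
number of not-yet-dead indices `k` with `k + 1 < j` is at most `dim R j` (`card_notDead_le`).  The monomial presentation is the
tree's `exists_monomial_along` (HLOST Lemma 2.7 iterated) from `x 0 = x 0 ^ 1 · 1` at `R 0`. OURS. [cite: HeinzerEtAl2015, Prop. 2.8] -/
theorem card_notDead_le_ringKrullDim {O : ValuationSubring K} {R : ℕ → Subring K}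
    (hreg : ∀ i, IsRegularLocalRing (R i)) (hdom : ∀ i, SubringDominates (R i) O.toSubring)
    (hstep : ∀ i, IsQuadraticTransformAlong O (R i) (R (i + 1)))
    (x : ℕ → K) (hxR : ∀ j, x j ∈ R j) (hx0 : ∀ j, x j ≠ 0) (hxv : ∀ j, O.valuation (x j) < 1)
    (hxdiv : ∀ j, ∀ y : K, y ∈ R j → O.valuation y < 1 → y / x j ∈ R (j + 1))
    (hx0rsop : IsRsopPart (fun _ : Fin 1 => (⟨x 0, hxR 0⟩ : R 0)))
    (j : ℕ) (F : Finset ℕ) (hFj : ∀ k ∈ F, k + 1 < j) (hF : ∀ k ∈ F, ∀ m : ℕ, x (k + 1) ^ m / x k ∉ R j) :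
    (F.card : WithBot ℕ∞) ≤ ringKrullDim (R j) := by
  classical
  haveI : ∀ i, IsLocalRing (R i) := fun i => inferInstance
  -- `x 0 = (x 0)^1 · 1` on the one-element part at `R 0`, transported to `R j` (HLOST Lemma 2.7 iterated)
  have hbase : ∃ (s : ℕ) (z : Fin s → R 0), IsRsopPart z ∧ ∃ (e : Fin s → ℕ) (u : R 0),
      IsUnit u ∧ x 0 = (∏ l, ((z l : R 0) : K) ^ e l) * (u : K) :=
    ⟨1, fun _ => ⟨x 0, hxR 0⟩, hx0rsop, fun _ => 1, 1, isUnit_one, by simp⟩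
  have hmon : ∃ (s : ℕ) (z : Fin s → R j), IsRsopPart z ∧ ∃ (e : Fin s → ℕ) (u : R j),
      IsUnit u ∧ x 0 = (∏ l, ((z l : R j) : K) ^ e l) * (u : K) := by
    have h := exists_monomial_along stub_rsopMonomialStep O R hstep hdom 0 (x 0) hbase j
    rwa [Nat.zero_add] at h
  obtain ⟨s, z, hz, e, u, hu, hx0j⟩ := hmon
  have hcard : F.card ≤ s := card_notDead_le hstep x hxR hx0 hxv hxdiv hz e u hu hx0j F hFj hF
  obtain ⟨-, e', -, hdim, -⟩ := hz
  rw [hdim]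
  exact_mod_cast hcard.trans (Nat.le_add_right s e')

end Literature.AlgebraicGeometry.Resolution.ShannonSequence.Hull

end Part5

/-!
## Part 6 — port of `Summits/ResolutionOfSingularities/ResolutionOfSingularities/Theorems/FrobeniusClosingSteerHullParameter.lean` (2 declarations kept)

# HLOST Proposition 3.8: a sequence of local quadratic transforms along a valuation has a HULL PARAMETER

`ringKrullDim_le_of_isQuadraticTransformAlong` (`dim R₁ ≤ dim R` for the quadratic transform of a regular local ring along `O`:
Matsumura Thm. 15.5 for the birational chart, through the tree's `ringKrullDim_localization_chartRing_le`; HLOST Remark 2.9),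
`ringKrullDim_sequence_le` (hence `dim R j ≤ dim R 0` along the sequence), and — in the last Part — the EXACT discharge of the named
fact `HeinzerEtAl2015HullParameterExists` (`ShannonHullParameter.lean`): exceptional parameters (`exists_excParam`); finitely many
eternal indices (`card_notDead_le_ringKrullDim` + `ringKrullDim_sequence_le`); past them every positive-value element of
`S = ⨆ R j` has a power divisible by `x i` (`pow_div_mem_shannonExt_of_dead`).  References: [HeinzerEtAl2015, Prop. 3.8, Prop. 2.8,
Remark 2.9]; [Matsumura1987, Thm. 15.5].
-/

section Part6

set_option autoImplicit false

namespace Literature.AlgebraicGeometry.Resolution.ShannonSequence.Hull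

open _root_.IsLocalRing
open Literature.AlgebraicGeometry.Resolution
open Literature.AlgebraicGeometry.Resolution.ShannonSequence
  (exists_ringEquiv_of_range_eq_rsopStep locToField_injective_rsopStep)

variable {K : Type u} [Field K]

/-! ## The Krull dimension does not grow along a quadratic transform -/

/-- **`dim R₁ ≤ dim R` for the quadratic transform `R₁` of a regular local ring `R ⊆ O` along `O`** (Matsumura Thm. 15.5 for the
birational chart `R[𝔪/x_i] ⊆ Frac R`): `R₁` is the localisation at the centre of `O` of the Rees chart `R[(x)/x_i]` of a regular
system of parameters `x` at a member `x_i` of maximal value (uniqueness of the transform), identified with the abstract chart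
`chartRing x i` through `locToField` (injective with image `R₁`), where the tree's `ringKrullDim_localization_chartRing_le` applies.
[cite: Matsumura1987, Thm. 15.5] [cite: HeinzerEtAl2015, Remark 2.9] -/
theorem ringKrullDim_le_of_isQuadraticTransformAlong (R : Subring K) [IsRegularLocalRing R] (O : ValuationSubring K)
    (hdom : SubringDominates R O.toSubring) (R₁ : Subring K) (h : IsQuadraticTransformAlong O R R₁) :
    ringKrullDim R₁ ≤ ringKrullDim R := by
  classical
  have hRO := h.source_le
  obtain ⟨x, hx⟩ := exists_regularSystemOfParameters (R := R)
  obtain ⟨_, x₀, hx₀m, hx₀0, -, -⟩ := h.exists_eq_locAtCentre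
  -- some parameter is nonzero (as `𝔪_R ≠ 0`)
  have hne : ∃ j ∈ (Finset.univ : Finset (Fin (maximalIdeal R).spanFinrank)), ((x j : R) : K) ≠ 0 := by
    by_contra hcon
    have hall : ∀ j, x j = 0 := fun j => by
      by_contra hj
      exact hcon ⟨j, Finset.mem_univ j, fun h0 => hj (Subtype.ext h0)⟩
    have hbot : Ideal.span (Set.range x) = ⊥ := by
      rw [Ideal.span_eq_bot]
      rintro _ ⟨j, rfl⟩
      exact hall j
    rw [hx] at hbot
    rw [hbot] at hx₀m
    exact hx₀0 ((Submodule.mem_bot _).mp hx₀m)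
  obtain ⟨i, -, hi0, hmax⟩ := exists_max_valuation O Finset.univ (fun j => ((x j : R) : K)) hne
  have hxi : x i ≠ 0 := fun h0 => hi0 (by rw [h0]; rfl)
  -- `R₁` is the transform in the `x_i`-chart
  have hspan : Ideal.span (↑(Finset.univ.image x) : Set R) = maximalIdeal R := by
    rw [Finset.coe_image, Finset.coe_univ, Set.image_univ, hx]
  have h' : IsQuadraticTransformAlong O R (locAtCentre (blowupRing R (x i : K)) O) := by
    refine ⟨‹_›, hRO, Finset.univ.image x, x i, hspan, Finset.mem_image_of_mem x (Finset.mem_univ i),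
      hxi, ?_, ?_⟩
    · intro y hy
      obtain ⟨j, -, rfl⟩ := Finset.mem_image.mp hy
      exact hmax j (Finset.mem_univ j)
    · rw [blowupRing_eq_closure_of_span_eq (x i : K) _ hspan]
  have hR₁ : R₁ = locAtCentre (blowupRing R (x i : K)) O := h.unique h'
  -- the abstract Rees chart, its centre, and the isomorphism `θ_L : B_N ≅ R₁`
  have hθ : R.subtype (x i) ≠ 0 := hi0
  have hRO' : ∀ r : R, R.subtype r ∈ O := fun r => hRO r.2
  have hmin' : ∀ j, O.valuation (R.subtype (x j)) ≤ O.valuation (R.subtype (x i)) :=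
    fun j => hmax j (Finset.mem_univ j)
  have hdom' : ∀ r ∈ maximalIdeal R, O.valuation (R.subtype r) < 1 := fun r hr =>
    ((subringDominates_valuationSubring_iff hRO).mp hdom r).mp hr
  set N := chartCentre x i R.subtype hθ O hRO' hmin' with hN
  have hNm : N.comap (chartBase x i) = maximalIdeal R :=
    comap_reesChartBase_chartCentre x i R.subtype hθ O hRO' hmin' hdom'
  set f := locToField x i R.subtype hθ O hRO' hmin' (Localization.AtPrime N) with hf
  have hfinj : Function.Injective f :=
    locToField_injective_rsopStep x i R.subtype hθ Subtype.val_injective O hRO' hmin' _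
  have hrange : f.range = R₁ := by
    rw [hR₁, hf, range_locToField,
      range_chartToField_eq_blowupRing x i R.subtype hθ hx R (Subring.range_subtype R)]
    rfl
  obtain ⟨e, -⟩ := exists_ringEquiv_of_range_eq_rsopStep f hfinj R₁ hrange
  rw [← ringKrullDim_eq_of_ringEquiv e]
  exact ringKrullDim_localization_chartRing_le x i N hNm (Localization.AtPrime N)

/-- Along a sequence of quadratic transforms of a regular local ring along a dominating valuation ring, the Krull dimension of the
members is bounded by that of the first one. [cite: HeinzerEtAl2015, Remark 2.9] [folklore] -/
theorem ringKrullDim_sequence_le {O : ValuationSubring K} {R : ℕ → Subring K} (hreg : IsRegularLocalRing (R 0))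
    (hdom : SubringDominates (R 0) O.toSubring) (hstep : ∀ i, IsQuadraticTransformAlong O (R i) (R (i + 1))) (j : ℕ) :
    ringKrullDim (R j) ≤ ringKrullDim (R 0) := by
  induction j with
  | zero => exact le_rfl
  | succ j ih =>
    haveI : IsRegularLocalRing (R j) := isRegularLocalRing_sequence hreg hstep j
    exact (ringKrullDim_le_of_isQuadraticTransformAlong (R j) O (sequence_dominates hdom hstep j).1 (R (j + 1))
      (hstep j)).trans ih

/-! ## HLOST Prop. 3.8 -/

end Literature.AlgebraicGeometry.Resolution.ShannonSequence.Hull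

end Part6

/-! ## Part 7 — the EXACT, universe-polymorphic discharge `HeinzerEtAl2015HullParameterExists_holds` -/

namespace Literature.AlgebraicGeometry.Resolution

open IsLocalRing ShannonSequence ShannonSequence.Hull

/-- **The named fact `HeinzerEtAl2015HullParameterExists` HOLDS, at every universe** (`ShannonHullParameter.lean`; HLOST
Proposition 3.8: along an infinite sequence of quadratic transforms of regular local rings along a dominating valuation ring `O`,
some member `R i` carries a regular parameter `x` with `𝔪_i ⊆ x R (i+1)` and `x S` primary for the maximal ideal of the Shannon
extension `S = ⨆ R j`).  EXACT-name discharge; proof: exceptional parameters (`Hull.exists_excParam`); finitely many eternal indices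
(`Hull.card_notDead_le_ringKrullDim` + `Hull.ringKrullDim_sequence_le`); past them every positive-value element of `S` has a power
divisible by `x i` (`Hull.pow_div_mem_shannonExt_of_dead`).  (The dimension hypothesis of Setting 3.1 is not even used.)
Literature-side, universe-polymorphic twin of the in-tree
`Summit.ResolutionOfSingularities.ResolutionOfSingularities.Theorems.SwitchingDichotomy.Hull.heinzerEtAl2015HullParameterExists_holds`
(there at universe `0`). [cite: HeinzerEtAl2015, Prop. 3.8] [cite: HeinzerEtAl2015, Prop. 2.8] -/
theorem HeinzerEtAl2015HullParameterExists_holds : HeinzerEtAl2015HullParameterExists.{u} := by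
  intro K _ O R hreg0 _hdim2 hdom0 hstep
  classical
  have hRreg : ∀ i, IsRegularLocalRing (R i) := isRegularLocalRing_sequence hreg0 hstep
  have hRdom : ∀ i, SubringDominates (R i) O.toSubring := fun i => (sequence_dominates hdom0 hstep i).1
  have hmono : Monotone R := sequence_monotone hstep
  -- exceptional parameters
  have hex : ∀ j, ∃ x : K, ∃ hxR : x ∈ R j, x ≠ 0 ∧ O.valuation x < 1 ∧
      IsRsopPart (fun _ : Fin 1 => (⟨x, hxR⟩ : R j)) ∧ ∀ y : K, y ∈ R j → O.valuation y < 1 → y / x ∈ R (j + 1) :=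
    fun j => exists_excParam (hRdom j) (hstep j)
  choose x hxR hx0 hxv hxrsop hxdiv using hex
  -- a uniform dimension bound
  set d : ℕ := (maximalIdeal (R 0)).spanFinrank with hd
  have hdim0 : ringKrullDim (R 0) = (d : WithBot ℕ∞) := (IsRegularLocalRing.spanFinrank_maximalIdeal (R := R 0)).symm
  have hdimj : ∀ j, ringKrullDim (R j) ≤ (d : WithBot ℕ∞) := fun j =>
    (ringKrullDim_sequence_le hreg0 hdom0 hstep j).trans hdim0.le
  -- the eternal indices form a finite set: every finite subset has at most `d` elements
  set E : Set ℕ := {k | ∀ (j m : ℕ), x (k + 1) ^ m / x k ∉ R j} with hE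
  have hEcard : ∀ F : Finset ℕ, (↑F : Set ℕ) ⊆ E → F.card ≤ d := by
    intro F hF
    -- a stage beyond all of `F`
    set j : ℕ := F.sup id + 2 with hj
    have hFj : ∀ k ∈ F, k + 1 < j := by
      intro k hk
      have : k ≤ F.sup id := Finset.le_sup (f := id) hk
      omega
    have hnd : ∀ k ∈ F, ∀ m : ℕ, x (k + 1) ^ m / x k ∉ R j := fun k hk m => hF (Finset.mem_coe.mpr hk) j m
    have h := card_notDead_le_ringKrullDim hRreg hRdom hstep x hxR hx0 hxv hxdiv (hxrsop 0) j F hFj hnd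
    exact_mod_cast h.trans (hdimj j)
  have hEfin : E.Finite := by
    by_contra hinf
    obtain ⟨F, hFE, hFcard⟩ := Set.Infinite.exists_subset_card_eq hinf (d + 1)
    have := hEcard F hFE
    omega
  -- an index past every eternal one
  obtain ⟨B, hB⟩ := hEfin.bddAbove
  set i : ℕ := B + 1 with hi
  have hdead : ∀ k, i ≤ k → ∃ (j m : ℕ), x (k + 1) ^ m / x k ∈ R j := by
    intro k hk
    by_contra hcon
    push Not at hcon
    have hkE : k ∈ E := hcon
    have := hB hkE
    omega
  -- the hull parameter is `x i`
  refine ⟨i, x i, inferInstance, fun _ => ⟨x i, hxR i⟩, hxrsop i, rfl, hxdiv i, ?_⟩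
  intro a ha hva
  -- `a ∈ R j'` for some `j' ≥ i + 1`, so `a / x j' ∈ R (j' + 1)`
  obtain ⟨j₀, hj₀⟩ := (Subring.mem_iSup_of_directed hmono.directed_le).mp ha
  set j' : ℕ := max j₀ (i + 1) with hj'
  have haj' : a ∈ R j' := hmono (le_max_left _ _) hj₀
  have hij' : i ≤ j' := (Nat.le_succ i).trans (le_max_right _ _)
  have hq : a / x j' ∈ R (j' + 1) := hxdiv j' a haj' hva
  -- `x j' ^ M / x i ∈ S` since every index in `[i, j')` dies
  obtain ⟨M, hM⟩ := pow_div_mem_shannonExt_of_dead x hx0 hij' (fun k hik _ => hdead k hik)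
  have hxj : x j' ≠ 0 := hx0 j'
  have hxi : x i ≠ 0 := hx0 i
  have hsplit : (a / x j') ^ M * (x j' ^ M / x i) = a ^ M / x i := by
    rw [div_pow, div_mul_div_comm, mul_comm (a ^ M), ← div_mul_div_comm, div_self (pow_ne_zero M hxj), one_mul]
  refine ⟨M, a ^ M / x i, ?_, ?_⟩
  · rw [← hsplit]
    exact Subring.mul_mem _ (Subring.pow_mem _ (le_shannonExt R (j' + 1) hq) M) hM
  · rw [div_mul_cancel₀ _ hxi]

end Literature.AlgebraicGeometry.Resolution

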